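import Summits.AnomalousDissipation.AnomalousDissipation.Theses.TaylorCertificates
import Literature.Analysis.FunctionSpaces.TorusTestFunction

/-!
# Cone structure of the non-witness set of `SmoothEulerCoerciveForce`

Crux `TaylorCertificates.SmoothEulerCoerciveForce` (stmt-AnomalousDissipation-14097), negative side
(cdisprove seat `refuter-cdisprove-stmt-AnomalousDissipation-14097-0`).

The Lamb map `v ↦ (v·∇)v` is quadratic, so the set of forces that DO admit a smooth divergence-free mean-zero
quiet Euler point (the non-witnesses of the crux) is a cone: if `v` is a quiet point of `f` then `c • v` is a
quiet point of `c² • f` (`quietPoint_smul`), and `f = 0` is never a witness (`zero_not_witness`, `v = 0`).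
Consequences recorded for provers: a witness may be normalised, and any proof of the crux must rest on a
scale-free property of the force.  Pure bookkeeping over the tree's `Torus.convect`, `Torus.divergence`
(`Torus.fderiv_const_smul`, `Torus.partialDeriv_const_smul`); no statement of the route is asserted.
-/

noncomputable section

open MeasureTheory
open scoped InnerProductSpace

namespace Summit.AnomalousDissipation.AnomalousDissipation.Theorems.SmoothEulerCoerciveForce.Negative

open Literature.Analysis.FunctionSpaces

/-- The divergence of the zero field vanishes. -/
theorem divergence_zero (x : UnitAddTorus (Fin 3)) :
    Torus.divergence (0 : UnitAddTorus (Fin 3) → EuclideanSpace ℝ (Fin 3)) x = 0 := by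
  simp [Torus.divergence, Torus.partialDeriv, Torus.lineDeriv]

/-- **`f = 0` is never a witness** of the crux: `v = 0` is a smooth divergence-free mean-zero quiet point. -/
theorem zero_not_witness :
    ¬ (∀ v : UnitAddTorus (Fin 3) → EuclideanSpace ℝ (Fin 3), Torus.IsSmooth v → Torus.IsDivFree v →
        Torus.HasZeroMean v →
        (∀ w : UnitAddTorus (Fin 3) → EuclideanSpace ℝ (Fin 3), Torus.IsSmooth w → Torus.IsDivFree w →
          Torus.HasZeroMean w →
          ∫ x, ⟪Torus.convect v v x - (0 : UnitAddTorus (Fin 3) → EuclideanSpace ℝ (Fin 3)) x, w x⟫_ℝ = 0) →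
        False) := by
  intro h
  refine h 0 (Torus.isSmooth_const (0 : EuclideanSpace ℝ (Fin 3))) (fun x => divergence_zero x) ?_ ?_
  · simp [Torus.HasZeroMean]
  · intro w _ _ _
    simp [Torus.convect]

/-- Divergence is homogeneous on smooth fields. -/
theorem divergence_const_smul {v : UnitAddTorus (Fin 3) → EuclideanSpace ℝ (Fin 3)} (hv : Torus.IsSmooth v)
    (c : ℝ) (x : UnitAddTorus (Fin 3)) :
    Torus.divergence (c • v) x = c * Torus.divergence v x := by
  unfold Torus.divergence
  rw [Finset.mul_sum]
  refine Finset.sum_congr rfl fun i _ => ?_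
  have h1 : Torus.IsContDiff 1 (fun y => v y i) := (hv.apply i).isContDiff (by simp)
  have : (fun y => (c • v) y i) = c • (fun y => v y i) := by
    funext y; simp
  rw [this, Torus.partialDeriv_const_smul h1 c i]
  simp

/-- The convective term is quadratic: `((c•v)·∇)(c•v) = c² • (v·∇)v` for smooth `v`. -/
theorem convect_const_smul {v : UnitAddTorus (Fin 3) → EuclideanSpace ℝ (Fin 3)} (hv : Torus.IsSmooth v)
    (c : ℝ) (x : UnitAddTorus (Fin 3)) :
    Torus.convect (c • v) (c • v) x = (c ^ 2) • Torus.convect v v x := by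
  unfold Torus.convect
  rw [Torus.fderiv_const_smul (hv.isContDiff (by simp)) c x]
  simp [pow_two, mul_smul, map_smul]

/-- **Cone structure.** If `v` is a smooth divergence-free mean-zero quiet Euler point of `f`, then `c • v`
is one of `c² • f`. -/
theorem quietPoint_smul {f v : UnitAddTorus (Fin 3) → EuclideanSpace ℝ (Fin 3)}
    (hv : Torus.IsSmooth v ∧ Torus.IsDivFree v ∧ Torus.HasZeroMean v ∧
      ∀ w : UnitAddTorus (Fin 3) → EuclideanSpace ℝ (Fin 3), Torus.IsSmooth w → Torus.IsDivFree w →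
        Torus.HasZeroMean w → ∫ x, ⟪Torus.convect v v x - f x, w x⟫_ℝ = 0)
    (c : ℝ) :
    Torus.IsSmooth (c • v) ∧ Torus.IsDivFree (c • v) ∧ Torus.HasZeroMean (c • v) ∧
      ∀ w : UnitAddTorus (Fin 3) → EuclideanSpace ℝ (Fin 3), Torus.IsSmooth w → Torus.IsDivFree w →
        Torus.HasZeroMean w → ∫ x, ⟪Torus.convect (c • v) (c • v) x - (c ^ 2 • f) x, w x⟫_ℝ = 0 := by
  obtain ⟨hs, hd, hz, hw⟩ := hv
  refine ⟨hs.smul c, fun x => ?_, ?_, fun w hws hwd hwz => ?_⟩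
  · rw [divergence_const_smul hs c x, hd x, mul_zero]
  · unfold Torus.HasZeroMean at hz ⊢
    simp [integral_smul, hz]
  · have h := hw w hws hwd hwz
    have hpt : ∀ x, ⟪Torus.convect (c • v) (c • v) x - (c ^ 2 • f) x, w x⟫_ℝ =
        c ^ 2 * ⟪Torus.convect v v x - f x, w x⟫_ℝ := by
      intro x
      rw [convect_const_smul hs c x, Pi.smul_apply, ← smul_sub, real_inner_smul_left]
    simp_rw [hpt]
    rw [integral_const_mul, h, mul_zero]

/-- **The non-witness set is a cone**: if `f` has a smooth divergence-free mean-zero quiet point, so does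
`c² • f` for every real `c`. -/
theorem not_witness_smul {f : UnitAddTorus (Fin 3) → EuclideanSpace ℝ (Fin 3)}
    (h : ∃ v : UnitAddTorus (Fin 3) → EuclideanSpace ℝ (Fin 3), Torus.IsSmooth v ∧ Torus.IsDivFree v ∧
      Torus.HasZeroMean v ∧
      ∀ w : UnitAddTorus (Fin 3) → EuclideanSpace ℝ (Fin 3), Torus.IsSmooth w → Torus.IsDivFree w →
        Torus.HasZeroMean w → ∫ x, ⟪Torus.convect v v x - f x, w x⟫_ℝ = 0)
    (c : ℝ) :
    ∃ v : UnitAddTorus (Fin 3) → EuclideanSpace ℝ (Fin 3), Torus.IsSmooth v ∧ Torus.IsDivFree v ∧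
      Torus.HasZeroMean v ∧
      ∀ w : UnitAddTorus (Fin 3) → EuclideanSpace ℝ (Fin 3), Torus.IsSmooth w → Torus.IsDivFree w →
        Torus.HasZeroMean w → ∫ x, ⟪Torus.convect v v x - (c ^ 2 • f) x, w x⟫_ℝ = 0 :=
  let ⟨v, hv⟩ := h
  ⟨c • v, quietPoint_smul hv c⟩

end Summit.AnomalousDissipation.AnomalousDissipation.Theorems.SmoothEulerCoerciveForce.Negative
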